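import Summits.CriticalPhenomena.Ising3DConformalLimit.Theorems.MoebiusLimitOfTwoPointLaw.Negative.EvenReduction

/-!
# `MoebiusLimitOfTwoPointLaw` (crux `stmt-CriticalPhenomena-4801`): SCALE COVARIANCE OF THE CANONICAL LIMIT IS FREE
# (negative-side support; sharpening of `EvenReduction.lean`)

Support file of the crux disprover (cdisprove seat, cycle 2). With the canonical renormalisation `ρ(δ) = δ^{-Δ}` the
identity `[c xᵢ/δ] = [xᵢ/(δ/c)]` makes the rescaled correlator at `c • x`, mesh `δ`, equal to `c^{-nΔ}` times the
rescaled correlator at `x`, mesh `δ/c`; hence ANY pointwise limit is scale covariant with dimension `Δ` on the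
non-coincident configurations (`scaleCovariant_of_canonical_limit`, MODEL-BLIND: every lattice family). Consequently
the prover's list of `EvenReduction.lean` loses scale covariance (`moebiusLimitOfTwoPointLaw_iff_even_sharp`): the crux
holds iff for every witness `(Δ, c)` of item 0634 there is a family `T` such that for every EVEN `n ≥ 4`
(i) `δ^{-nΔ}⟨σ_{[x₁/δ]}⋯σ_{[xₙ/δ]}⟩_{β_c} → T_n` locally uniformly off the diagonals, (ii) `T_n` is translation
invariant, (iii) `O(3)` invariant, (iv) covariant under the unit inversion with weight `Δ`. `sorry`-free.
-/

noncomputable section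

namespace Summit.CriticalPhenomena.Ising3DConformalLimit.Theorems.MoebiusLimitOfTwoPointLaw.Negative

open Literature.Probability.LatticeModels Filter Topology EuclideanGeometry
open Summit.CriticalPhenomena.Ising3DConformalLimit.Theses.PrecisionLaplacian (MoebiusLimitOfTwoPointLaw)

/-! ## §1 Scale covariance of canonical limits (model-blind) -/

/-- `[c x/δ] = [x/(δ/c)]`: dilating the configuration is refining the mesh. -/
theorem latticeApprox_smul (δ : ℝ) (c : ℝ) (p : EuclideanSpace ℝ (Fin 3)) :
    latticeApprox δ (c • p) = latticeApprox (δ / c) p := by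
  funext j
  rw [latticeApprox_apply, latticeApprox_apply, PiLp.smul_apply, smul_eq_mul, div_div_eq_mul_div, mul_comm]

/-- The canonically rescaled correlator at `c • x`, mesh `δ`, is `c^{-nΔ}` times the one at `x`, mesh `δ/c`. -/
theorem rescaledCorrelator_canonical_smul (G : LatticeCorrFamily 3) (Δ : ℝ) (n : ℕ) {δ c : ℝ} (hδ : 0 < δ)
    (hc : 0 < c) (x : Fin n → EuclideanSpace ℝ (Fin 3)) :
    rescaledCorrelator G (fun δ => δ ^ (-Δ)) n δ (fun i => c • x i) =
      c ^ (-(n : ℝ) * Δ) * rescaledCorrelator G (fun δ => δ ^ (-Δ)) n (δ / c) x := by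
  rw [rescaledCorrelator_apply, rescaledCorrelator_apply, ← mul_assoc]
  have hcn : c ^ (-(n : ℝ) * Δ) ≠ 0 := (Real.rpow_pos_of_pos hc _).ne'
  congr 1
  · rw [Real.div_rpow hδ.le hc.le, div_pow, ← Real.rpow_natCast (c ^ (-Δ)) n, ← Real.rpow_mul hc.le,
      show -Δ * (n : ℝ) = -(n : ℝ) * Δ by ring]
    field_simp
  · congr 1
    funext i
    exact latticeApprox_smul δ c (x i)

/-- `δ ↦ δ/c` maps `0⁺` to `0⁺` (`c > 0`). -/
theorem tendsto_div_const_nhdsGT {c : ℝ} (hc : 0 < c) :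
    Tendsto (fun δ : ℝ => δ / c) (𝓝[>] (0 : ℝ)) (𝓝[>] (0 : ℝ)) := by
  refine tendsto_nhdsWithin_of_tendsto_nhds_of_eventually_within _ ?_ ?_
  · have h : Tendsto (fun δ : ℝ => δ / c) (𝓝 0) (𝓝 (0 / c)) := (continuous_id.div_const c).tendsto 0
    rw [zero_div] at h
    exact tendsto_nhdsWithin_of_tendsto_nhds h
  · filter_upwards [self_mem_nhdsWithin] with δ hδ
    exact div_pos hδ hc

/-- **Scale covariance is free for canonical limits** (every lattice family): if the `δ^{-Δ}`-rescaled `n`-point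
correlators converge pointwise on `NonCoincident` to `T`, then `T (c • x) = c^{-nΔ} T x` there. -/
theorem scaleCovariant_of_canonical_limit {G : LatticeCorrFamily 3} {Δ : ℝ} {n : ℕ}
    {T : (Fin n → EuclideanSpace ℝ (Fin 3)) → ℝ}
    (h : ∀ x ∈ NonCoincident 3 n,
      Tendsto (fun δ => rescaledCorrelator G (fun δ => δ ^ (-Δ)) n δ x) (𝓝[>] 0) (𝓝 (T x)))
    {c : ℝ} (hc : 0 < c) {x : Fin n → EuclideanSpace ℝ (Fin 3)} (hx : x ∈ NonCoincident 3 n) :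
    T (fun i => c • x i) = c ^ (-(n : ℝ) * Δ) * T x := by
  have hcx : (fun i => c • x i) ∈ NonCoincident 3 n := by
    rw [mem_nonCoincident] at hx ⊢
    exact fun i j hij => hx (smul_right_injective _ hc.ne' hij)
  have h1 := h _ hcx
  have h2 : Tendsto (fun δ => rescaledCorrelator G (fun δ => δ ^ (-Δ)) n δ (fun i => c • x i)) (𝓝[>] 0)
      (𝓝 (c ^ (-(n : ℝ) * Δ) * T x)) := by
    have h3 := ((h x hx).comp (tendsto_div_const_nhdsGT hc)).const_mul (c ^ (-(n : ℝ) * Δ))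
    refine h3.congr' ?_
    filter_upwards [self_mem_nhdsWithin] with δ hδ
    rw [Function.comp_apply, rescaledCorrelator_canonical_smul G Δ n hδ hc x]
  exact tendsto_nhds_unique h1 h2

/-! ## §2 The sharpened reduction -/

open Classical in
/-- Truncation off the coincident locus. -/
def truncate (T : CorrFamily 3) : CorrFamily 3 := fun n x => if x ∈ NonCoincident 3 n then T n x else 0

/-- The truncation agrees with `T` on non-coincident configurations. -/
theorem truncate_of_mem (T : CorrFamily 3) {n : ℕ} {x : Fin n → EuclideanSpace ℝ (Fin 3)}
    (hx : x ∈ NonCoincident 3 n) : truncate T n x = T n x := by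
  simp [truncate, hx]

/-- The truncation vanishes off `NonCoincident`. -/
theorem truncate_of_not_mem (T : CorrFamily 3) {n : ℕ} {x : Fin n → EuclideanSpace ℝ (Fin 3)}
    (hx : x ∉ NonCoincident 3 n) : truncate T n x = 0 := by
  simp [truncate, hx]

/-- A variant of `isMoebiusCovariant_assemble` asking covariance of `T` only in the even arities `≥ 4`, and
assembling the TRUNCATION of `T`; scale covariance is taken on `NonCoincident` only. -/
theorem isMoebiusCovariant_assemble_truncate (c : ℝ) {Δ : ℝ} {T : CorrFamily 3}
    (ht : ∀ n, 4 ≤ n → Even n → ∀ (v : EuclideanSpace ℝ (Fin 3)) (x : Fin n → EuclideanSpace ℝ (Fin 3)),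
      T n (fun i => x i + v) = T n x)
    (hr : ∀ n, 4 ≤ n → Even n → ∀ (R : EuclideanSpace ℝ (Fin 3) ≃ₗᵢ[ℝ] EuclideanSpace ℝ (Fin 3))
      (x : Fin n → EuclideanSpace ℝ (Fin 3)), T n (fun i => R (x i)) = T n x)
    (hs : ∀ n, 4 ≤ n → Even n → ∀ a : ℝ, 0 < a → ∀ x ∈ NonCoincident 3 n,
      T n (fun i => a • x i) = a ^ (-(n : ℝ) * Δ) * T n x)
    (hi : ∀ n, 4 ≤ n → Even n → ∀ x : Fin n → EuclideanSpace ℝ (Fin 3), (∀ i, x i ≠ 0) →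
      T n (fun i => inversion 0 1 (x i)) = (∏ i, ‖x i‖ ^ (2 * Δ)) * T n x) :
    IsMoebiusCovariant Δ (assemble c Δ (truncate T)) := by
  -- Möbius covariance of the truncation in the even arities ≥ 4, then `isMoebiusCovariant_assemble`-style dispatch
  have key : ∀ n : ℕ, n = 0 ∨ n = 2 ∨ Odd n ∨ (Even n ∧ 4 ≤ n) := by
    intro n
    rcases Nat.even_or_odd n with he | ho
    · rcases Nat.lt_or_ge n 4 with hlt | hge
      · interval_cases n
        · exact Or.inl rfl
        · exact absurd he (by decide)
        · exact Or.inr (Or.inl rfl)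
        · exact absurd he (by decide)
      · exact Or.inr (Or.inr (Or.inr ⟨he, hge⟩))
    · exact Or.inr (Or.inr (Or.inl ho))
  -- membership transport lemmas
  have mem_add : ∀ {n} (v : EuclideanSpace ℝ (Fin 3)) (x : Fin n → EuclideanSpace ℝ (Fin 3)),
      (fun i => x i + v) ∈ NonCoincident 3 n ↔ x ∈ NonCoincident 3 n := by
    intro n v x
    rw [mem_nonCoincident, mem_nonCoincident]
    exact ⟨fun h i j hij => h (by simp [hij]), fun h i j hij => h (add_right_cancel hij)⟩
  have mem_map : ∀ {n} (R : EuclideanSpace ℝ (Fin 3) ≃ₗᵢ[ℝ] EuclideanSpace ℝ (Fin 3))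
      (x : Fin n → EuclideanSpace ℝ (Fin 3)),
      (fun i => R (x i)) ∈ NonCoincident 3 n ↔ x ∈ NonCoincident 3 n := by
    intro n R x
    rw [mem_nonCoincident, mem_nonCoincident]
    exact ⟨fun h i j hij => h (by simp [hij]), fun h i j hij => h (R.injective hij)⟩
  have mem_smul : ∀ {n} {a : ℝ} (_ : 0 < a) (x : Fin n → EuclideanSpace ℝ (Fin 3)),
      (fun i => a • x i) ∈ NonCoincident 3 n ↔ x ∈ NonCoincident 3 n := by
    intro n a ha x
    rw [mem_nonCoincident, mem_nonCoincident]
    exact ⟨fun h i j hij => h (by simp [hij]), fun h i j hij => h (smul_right_injective _ ha.ne' hij)⟩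
  have mem_inv : ∀ {n} (x : Fin n → EuclideanSpace ℝ (Fin 3)),
      (fun i => inversion 0 1 (x i)) ∈ NonCoincident 3 n ↔ x ∈ NonCoincident 3 n := by
    intro n x
    rw [mem_nonCoincident, mem_nonCoincident]
    exact ⟨fun h i j hij => h (by simp [hij]),
      fun h i j hij => h (inversion_injective (0 : EuclideanSpace ℝ (Fin 3)) one_ne_zero hij)⟩
  -- the truncated family is Möbius covariant in every even arity ≥ 4; package as a full `IsMoebiusCovariant`
  -- statement for the family `U n := if 4 ≤ n ∧ Even n then truncate T n else 0` and reuse `isMoebiusCovariant_assemble`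
  set U : CorrFamily 3 := fun n => if 4 ≤ n ∧ Even n then truncate T n else fun _ => 0 with hU
  have hUeq : ∀ n, 4 ≤ n → Even n → U n = truncate T n := fun n h4 he => by simp [hU, h4, he]
  have hUne : ∀ n, ¬ (4 ≤ n ∧ Even n) → U n = fun _ => 0 := fun n h => by simp [hU, h]
  have hUM : IsMoebiusCovariant Δ U := by
    refine ⟨⟨fun n v x => ?_, fun n R x => ?_⟩, fun n a ha x => ?_, fun n x hx => ?_⟩
    · by_cases h : 4 ≤ n ∧ Even n
      · rw [hUeq n h.1 h.2]
        by_cases hx : x ∈ NonCoincident 3 n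
        · rw [truncate_of_mem T ((mem_add v x).2 hx), truncate_of_mem T hx, ht n h.1 h.2 v x]
        · rw [truncate_of_not_mem T (mt (mem_add v x).1 hx), truncate_of_not_mem T hx]
      · rw [hUne n h]
    · by_cases h : 4 ≤ n ∧ Even n
      · rw [hUeq n h.1 h.2]
        by_cases hx : x ∈ NonCoincident 3 n
        · rw [truncate_of_mem T ((mem_map R x).2 hx), truncate_of_mem T hx, hr n h.1 h.2 R x]
        · rw [truncate_of_not_mem T (mt (mem_map R x).1 hx), truncate_of_not_mem T hx]
      · rw [hUne n h]
    · by_cases h : 4 ≤ n ∧ Even n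
      · rw [hUeq n h.1 h.2]
        by_cases hx : x ∈ NonCoincident 3 n
        · rw [truncate_of_mem T ((mem_smul ha x).2 hx), truncate_of_mem T hx, hs n h.1 h.2 a ha x hx]
        · rw [truncate_of_not_mem T (mt (mem_smul ha x).1 hx), truncate_of_not_mem T hx, mul_zero]
      · rw [hUne n h, mul_zero]
    · by_cases h : 4 ≤ n ∧ Even n
      · rw [hUeq n h.1 h.2]
        by_cases hmem : x ∈ NonCoincident 3 n
        · rw [truncate_of_mem T ((mem_inv x).2 hmem), truncate_of_mem T hmem, hi n h.1 h.2 x hx]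
        · rw [truncate_of_not_mem T (mt (mem_inv x).1 hmem), truncate_of_not_mem T hmem, mul_zero]
      · rw [hUne n h, mul_zero]
  -- `assemble` only reads the even arities ≥ 4, where `U = truncate T`
  have hassemble : assemble c Δ (truncate T) = assemble c Δ U := by
    funext n x
    rcases key n with h0 | h2 | ho | ⟨he, h4⟩
    · subst h0; rfl
    · subst h2; rfl
    · rw [assemble_odd c Δ _ ho, assemble_odd c Δ _ ho]
    · rw [assemble_even c Δ _ he h4, assemble_even c Δ _ he h4, hUeq n h4 he]
  rw [hassemble]
  exact isMoebiusCovariant_assemble c hUM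

/-- **Reduction of the crux to the even arities `n ≥ 4`, scale covariance free.** `MoebiusLimitOfTwoPointLaw` holds
iff for every witness `(Δ, c)` of item 0634 there is a family `T` such that for every EVEN `n ≥ 4`:
`δ^{-nΔ}⟨σ_{[x₁/δ]}⋯σ_{[xₙ/δ]}⟩_{β_c} → T_n` locally uniformly off the diagonals, and `T_n` is translation invariant,
`O(3)` invariant and covariant under the unit inversion with weight `Δ` (scale covariance with the two-point
exponent then holds automatically on non-coincident configurations). -/
theorem moebiusLimitOfTwoPointLaw_iff_even_sharp :
    MoebiusLimitOfTwoPointLaw ↔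
      ∀ Δ c : ℝ, 0 < c →
        Tendsto (fun x : Site 3 =>
          criticalTwoPoint 3 x * Real.sqrt (∑ i, ((x i : ℝ)) ^ 2) ^ (2 * Δ)) cofinite (nhds c) →
        ∃ T : CorrFamily 3,
          (∀ n, 4 ≤ n → Even n → TendstoLocallyUniformlyOn
            (rescaledCorrelator (criticalCorr 3) (fun δ => δ ^ (-Δ)) n) (T n) (𝓝[>] (0 : ℝ))
            (NonCoincident 3 n)) ∧
          (∀ n, 4 ≤ n → Even n → ∀ (v : EuclideanSpace ℝ (Fin 3)) (x : Fin n → EuclideanSpace ℝ (Fin 3)),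
            T n (fun i => x i + v) = T n x) ∧
          (∀ n, 4 ≤ n → Even n → ∀ (R : EuclideanSpace ℝ (Fin 3) ≃ₗᵢ[ℝ] EuclideanSpace ℝ (Fin 3))
            (x : Fin n → EuclideanSpace ℝ (Fin 3)), T n (fun i => R (x i)) = T n x) ∧
          (∀ n, 4 ≤ n → Even n → ∀ x : Fin n → EuclideanSpace ℝ (Fin 3), (∀ i, x i ≠ 0) →
            T n (fun i => inversion 0 1 (x i)) = (∏ i, ‖x i‖ ^ (2 * Δ)) * T n x) := by
  rw [moebiusLimitOfTwoPointLaw_iff_even]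
  constructor
  · intro h Δ c hc hP
    obtain ⟨T, hM, hT⟩ := h Δ c hc hP
    obtain ⟨⟨ht, hr⟩, -, hi⟩ := hM
    exact ⟨T, hT, fun n _ _ => ht n, fun n _ _ => hr n, fun n _ _ => hi n⟩
  · intro h Δ c hc hP
    obtain ⟨T, hT, ht, hr, hi⟩ := h Δ c hc hP
    -- scale covariance on `NonCoincident` is free
    have hs : ∀ n, 4 ≤ n → Even n → ∀ a : ℝ, 0 < a → ∀ x ∈ NonCoincident 3 n,
        T n (fun i => a • x i) = a ^ (-(n : ℝ) * Δ) * T n x :=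
      fun n h4 he a ha x hx => scaleCovariant_of_canonical_limit (fun y hy => (hT n h4 he).tendsto_at hy) ha hx
    refine ⟨assemble c Δ (truncate T), ?_, ?_⟩
    · -- the assembled truncation is Möbius covariant … but `moebiusLimitOfTwoPointLaw_iff_even` wants a Möbius `T'`
      -- with the convergence; take `T' := assemble c Δ (truncate T)` itself: its even arities ≥ 4 are `truncate T n`
      exact isMoebiusCovariant_assemble_truncate c ht hr hs hi
    · intro n h4 he
      refine ((hT n h4 he).congr_right fun x hx => ?_)
      rw [assemble_even c Δ _ he h4, truncate_of_mem T hx]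

end Summit.CriticalPhenomena.Ising3DConformalLimit.Theorems.MoebiusLimitOfTwoPointLaw.Negative

end
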